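import Summits.PneNP.PneNP.Theorems.NegLimitedAmplifiedWindowAmpDefs
import Mathlib
import HarnessLib

/-!
# Amplified critical window — stub A, part A2 `BalancedTrim` (exact balance of the hard-core measure)
(cell pnp-ideate, rung F-N1/p3, ROUND-12; line `amplified-window` on item stmt-PneNP-19860, stub A
`MonotoneAmplification`; typed part `Amp.BalancedTrim` of `NegLimitedAmplifiedWindowAmpDefs.lean`, blueprint
HOME/pnp-ideate-p3/r12/BLUEPRINT-A.md §4)

`balancedTrim_holds : BalancedTrim` — a hard-core measure `H` (mass `Z = Σ D·H ≥ β`, ONE-SIDED advantage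
`< γZ` for a class containing both constants, `0 < γ ≤ ½`) is rescaled separately on `{f = 1}` and `{f = 0}`
(factors `c_b = p/(2 Z_b) ≤ 1`, where the constants give `Z_b > (1−γ)Z/2 ≥ p/2`) into `H' ∈ [0,1]` with
`D·H'` EXACTLY balanced of total mass `p`; the advantage of every `g` in the class becomes `≤ 2γp ≤ 4γp`
(only the upper bounds `A_b ≤ Z_b` and `A_1 + A_0 < γZ` are used — one-sided throughout).  Pure finite sums.

References: R. Impagliazzo, *Hard-core distributions for somewhat hard problems*, FOCS 1995 (measures vs.
sets); BLUEPRINT-A §4 (this normalisation).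

HONEST FRAMING: a sub-lemma of the OPEN stub A; nothing here bears on P vs NP.
-/

set_option linter.dupNamespace false -- `Summit.PneNP.PneNP.…`: summit = sub-problem name (D-0017 single-conjunct layout)

namespace Summit.PneNP.PneNP.Theorems.NegLimitedAmplifiedWindow.Amp

open Finset
open Summit.PneNP.PneNP.Theorems.NegLimitedDoor (massAt agreeAt)

/-- The key one-sided inequality behind the trim: `A_b ≤ Z_b`, `A₁ + A₀ ≤ γ(Z₀+Z₁)`, `|Z₁ − Z₀| ≤ γ(Z₀+Z₁)`
give `A₁ Z₀ + A₀ Z₁ ≤ 4γ Z₀ Z₁`. -/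
theorem trim_ineq {A₁ A₀ Z₁ Z₀ γ : ℝ} (hZ₁ : 0 < Z₁) (hZ₀ : 0 < Z₀) (hγ : 0 ≤ γ) (hA₁ : A₁ ≤ Z₁) (hA₀ : A₀ ≤ Z₀)
    (hsum : A₁ + A₀ ≤ γ * (Z₀ + Z₁)) (hd₁ : Z₁ - Z₀ ≤ γ * (Z₀ + Z₁)) (hd₀ : Z₀ - Z₁ ≤ γ * (Z₀ + Z₁)) :
    A₁ * Z₀ + A₀ * Z₁ ≤ 4 * γ * (Z₀ * Z₁) := by
  rcases le_total Z₁ Z₀ with h | h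
  · -- `A₁ Z₀ + A₀ Z₁ = (A₁ + A₀) Z₁ + A₁ (Z₀ − Z₁)`
    have h1 : (A₁ + A₀) * Z₁ ≤ γ * (Z₀ + Z₁) * Z₁ := mul_le_mul_of_nonneg_right hsum hZ₁.le
    have h2 : A₁ * (Z₀ - Z₁) ≤ Z₁ * (Z₀ - Z₁) := mul_le_mul_of_nonneg_right hA₁ (by linarith)
    have h3 : Z₁ * (Z₀ - Z₁) ≤ Z₁ * (γ * (Z₀ + Z₁)) := mul_le_mul_of_nonneg_left hd₀ hZ₁.le
    have h4 : γ * Z₁ * Z₁ ≤ γ * Z₁ * Z₀ := mul_le_mul_of_nonneg_left h (mul_nonneg hγ hZ₁.le)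
    linarith
  · have h1 : (A₁ + A₀) * Z₀ ≤ γ * (Z₀ + Z₁) * Z₀ := mul_le_mul_of_nonneg_right hsum hZ₀.le
    have h2 : A₀ * (Z₁ - Z₀) ≤ Z₀ * (Z₁ - Z₀) := mul_le_mul_of_nonneg_right hA₀ (by linarith)
    have h3 : Z₀ * (Z₁ - Z₀) ≤ Z₀ * (γ * (Z₀ + Z₁)) := mul_le_mul_of_nonneg_left hd₁ hZ₀.le
    have h4 : γ * Z₀ * Z₀ ≤ γ * Z₀ * Z₁ := mul_le_mul_of_nonneg_left h (mul_nonneg hγ hZ₀.le)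
    linarith

/-- **A2 `BalancedTrim`**, BY NAME. -/
theorem balancedTrim_holds : BalancedTrim := by
  intro X _ D H f 𝒢 β γ p hD hH0 hH1 hγ hγ2 hp hpβ hβ htt hff hadv
  classical
  -- masses and signed sums on the two sides of `f`
  set Z : ℝ := ∑ x, D x * H x with hZ
  set Zb : Bool → ℝ := fun b => ∑ x, if f x = b then D x * H x else 0 with hZb
  have hZsplit : ∑ x, D x * H x = Zb true + Zb false := by
    rw [hZb]; dsimp only; rw [← Finset.sum_add_distrib]
    exact Finset.sum_congr rfl fun x _ => by cases f x <;> simp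
  have hDH : ∀ x, 0 ≤ D x * H x := fun x => mul_nonneg (hD x) (hH0 x)
  have hZb0 : ∀ b, 0 ≤ Zb b := fun b => Finset.sum_nonneg fun x _ => by split_ifs; exacts [hDH x, le_rfl]
  -- the constants bound `|Z₁ − Z₀|`
  have hconst : ∀ b, ∑ x, D x * H x * (if b = f x then (1 : ℝ) else -1) = Zb b - Zb (!b) := by
    intro b
    rw [hZb]; dsimp only; rw [← Finset.sum_sub_distrib]
    exact Finset.sum_congr rfl fun x _ => by cases f x <;> cases b <;> simp
  have hd₁ : Zb true - Zb false ≤ γ * (Zb false + Zb true) := by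
    have h := hadv _ htt; rw [hconst, hZ, hZsplit] at h; simp only [Bool.not_true] at h; linarith
  have hd₀ : Zb false - Zb true ≤ γ * (Zb false + Zb true) := by
    have h := hadv _ hff; rw [hconst, hZ, hZsplit] at h; simp only [Bool.not_false] at h; linarith
  -- hence both sides carry mass `> p/2`
  have hZge : β ≤ Zb true + Zb false := by rw [← hZsplit, ← hZ]; exact hβ
  have hpZ : p ≤ (1 - γ) * (Zb true + Zb false) := hpβ.trans (mul_le_mul_of_nonneg_left hZge (by linarith))
  have hZbpos : ∀ b, p / 2 < Zb b ∨ p / 2 = Zb b → 0 < Zb b := fun b h => by rcases h with h | h <;> linarith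
  have hZt : p ≤ 2 * Zb true := by nlinarith
  have hZf : p ≤ 2 * Zb false := by nlinarith
  have hZt0 : 0 < Zb true := by linarith
  have hZf0 : 0 < Zb false := by linarith
  -- the trim
  set c : Bool → ℝ := fun b => p / (2 * Zb b) with hc
  have hc0 : ∀ b, 0 < c b := fun b => by cases b <;> positivity
  have hc1 : ∀ b, c b ≤ 1 := fun b => by
    cases b
    · exact (div_le_one (by linarith)).2 hZf
    · exact (div_le_one (by linarith)).2 hZt
  have hcZ : ∀ b, c b * Zb b = p / 2 := fun b => by
    have : Zb b ≠ 0 := by cases b <;> positivity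
    rw [hc]; field_simp
  refine ⟨fun x => c (f x) * H x, fun x => mul_nonneg (hc0 _).le (hH0 x),
    fun x => mul_le_one₀ (hc1 _) (hH0 x) (hH1 x), ?_, ?_, ?_⟩
  · -- mass on `{f = 1}`
    rw [← hcZ true]
    unfold massAt
    rw [hZb]; dsimp only; rw [Finset.mul_sum]
    refine Finset.sum_congr rfl fun x _ => ?_
    by_cases h : f x = true
    · simp only [h, if_true]; ring
    · simp [h]
  · rw [← hcZ false]
    unfold massAt
    rw [hZb]; dsimp only; rw [Finset.mul_sum]
    refine Finset.sum_congr rfl fun x _ => ?_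
    by_cases h : f x = false
    · simp only [h, if_true]; ring
    · simp [h]
  · -- advantage
    intro g hg
    set Ab : Bool → ℝ := fun b => ∑ x, if f x = b then D x * H x * (if g x = f x then (1 : ℝ) else -1) else 0
      with hAb
    have hsplit : ∑ x, D x * (c (f x) * H x) * (if g x = f x then (1 : ℝ) else -1) =
        c true * Ab true + c false * Ab false := by
      rw [hAb]; dsimp only; rw [Finset.mul_sum, Finset.mul_sum, ← Finset.sum_add_distrib]
      refine Finset.sum_congr rfl fun x _ => ?_
      cases f x <;> simp <;> ring
    have hAsum : Ab true + Ab false ≤ γ * (Zb false + Zb true) := by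
      have h := hadv g hg
      have : Ab true + Ab false = ∑ x, D x * H x * (if g x = f x then (1 : ℝ) else -1) := by
        rw [hAb]; dsimp only; rw [← Finset.sum_add_distrib]
        exact Finset.sum_congr rfl fun x _ => by cases f x <;> simp
      rw [this]; rw [hZ, hZsplit] at h; linarith
    have hAle : ∀ b, Ab b ≤ Zb b := fun b => Finset.sum_le_sum fun x _ => by
      by_cases h : f x = b
      · simp only [h, if_true]
        have := hDH x
        split_ifs <;> linarith
      · simp [h]
    have key := trim_ineq hZt0 hZf0 hγ.le (hAle true) (hAle false) hAsum hd₁ hd₀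
    rw [hsplit, hc]
    dsimp only
    rw [div_mul_eq_mul_div, div_mul_eq_mul_div, div_add_div _ _ (by positivity) (by positivity),
      div_le_iff₀ (by positivity)]
    have k2 : 2 * p * (Ab true * Zb false + Ab false * Zb true) ≤ 2 * p * (4 * γ * (Zb false * Zb true)) :=
      mul_le_mul_of_nonneg_left key (by positivity)
    have k3 : 0 ≤ γ * p * (Zb false * Zb true) := by positivity
    linarith

end Summit.PneNP.PneNP.Theorems.NegLimitedAmplifiedWindow.Amp
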